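import Summits.ValiantsHypothesis.ValiantsHypothesis.Theorems.KPlusLogSqLawStaticPathCountLocal

/-!
# Route «KPlusLogSqLaw» — chains of unique optima of parametric max-weight independent set on a path have `O(n log n)` terms

HONEST FRAMING.  Helper toward the crux `WeakLifting` (item `stmt-ValiantsHypothesis-19561`, route `KPlusLogSqLaw`, cell `pub-symmetroid`,
seat val-sym-lift-p3 g6, 2026-08-27) on the line of its witness-plan stub `stub_tridiagonalSectorB`: the tropical twin of the STATIC tridiagonal
sector (val-sym-lift-p4 g6 `HOME/val-sym-lift-p4/STATIC-PATH-NLOGN.md`).  The CONSUMABLE form of the kernel `O(n log n)` law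
(`exists_cert_opt_of_altSum_ne`, `KPlusLogSqLawStaticPathCountLocal.lean`) in the shape of the tree's dominant chains: if at strictly
increasing parameters `θ_0 < ⋯ < θ_N` the independent sets `M_0, …, M_N` of the block `i+1, …, i+n` are each the UNIQUE maximiser of the total
weight, consecutive ones distinct, and no alternating interval sum of the item lines inside the block vanishes identically, then
`N ≤ 66 · n · (⌊log₂ n⌋ + 2)` (`StaticPathFold.chain_le`).  Mechanism: between two consecutive parameters the optimum cannot be affine (a finite
maximum of lines that is affine on a non-trivial interval coincides with one of the lines, which would then be the unique maximiser at both
ends), so each gap contains a point of the kink certificate, injectively.  What is NOT done here: the identification of dominant chains of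
static tridiagonal DESIGNS (`IsDominant` vocabulary) with such chains (terms ↔ path matchings by `BandOne`, valuations ↔ intercepts) and the
removal of the non-degeneracy hypothesis by scaling-and-perturbing integer valuations.  Nothing here asserts anything about `WeakLifting`,
`TropicalB`, `KPlusLogSqLaw`, the stub in its window, `MatrixDescartes` (stmt-ValiantsHypothesis-18050) or `VP ≠ VNP`.
-/

set_option linter.dupNamespace false
set_option autoImplicit false

namespace Summit.ValiantsHypothesis.ValiantsHypothesis.Theorems.KPlusLogSqLaw

open Finset Classical PiecewiseAffine

namespace StaticPathFold

noncomputable section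

variable (w₁ w₀ : ℕ → ℝ)

/-- the total weight of a set of items is an affine function of the parameter. [folklore] -/
theorem sum_W_eq (S : Finset ℕ) (θ : ℝ) :
    ∑ t ∈ S, W w₁ w₀ t θ = (∑ t ∈ S, w₁ t) * θ + ∑ t ∈ S, w₀ t := by
  unfold W
  rw [Finset.sum_add_distrib, Finset.sum_mul]

/-- **a unique maximiser pins the optimum off any affine stretch**: if `M` is the unique maximiser at `x`, `M'` the unique maximiser at
`y > x`, `M ≠ M'`, then the optimum is not affine on `[x, y]`. [folklore] -/
theorem not_affine_of_unique {i n : ℕ} {x y : ℝ} (hxy : x < y) {M M' : Finset ℕ} (hM : M ∈ indepSets i n)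
    (huM : ∀ S ∈ indepSets i n, S ≠ M → ∑ t ∈ S, W w₁ w₀ t x < ∑ t ∈ M, W w₁ w₀ t x) (hM' : M' ∈ indepSets i n)
    (huM' : ∀ S ∈ indepSets i n, S ≠ M' → ∑ t ∈ S, W w₁ w₀ t y < ∑ t ∈ M', W w₁ w₀ t y) (hne : M ≠ M')
    (p q : ℝ) : ¬ ∀ τ ∈ Set.Icc x y, opt w₁ w₀ i n τ = p * τ + q := by
  intro haff
  -- some independent set's line coincides with `p τ + q`: otherwise each line meets it at most once, but `[x, y]` is infinite
  have key : ∃ S ∈ indepSets i n, ∀ τ, ∑ t ∈ S, W w₁ w₀ t τ = p * τ + q := by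
    by_contra hnone
    push Not at hnone
    -- for each `S`, the agreement set inside `[x, y]` has at most one point; collect one such point per `S` (if any)
    have hfin : ∀ S ∈ indepSets i n, ∃ c : ℝ, ∀ τ, ∑ t ∈ S, W w₁ w₀ t τ = p * τ + q → τ = c := by
      intro S hS
      obtain ⟨τ₀, hτ₀⟩ := hnone S hS
      by_cases hslope : ∑ t ∈ S, w₁ t = p
      · -- same slope, different intercept: never equal
        refine ⟨0, fun τ hτ => ?_⟩
        exfalso
        rw [sum_W_eq, hslope] at hτ hτ₀
        exact hτ₀ (by linarith)
      · refine ⟨(q - ∑ t ∈ S, w₀ t) / (∑ t ∈ S, w₁ t - p), fun τ hτ => ?_⟩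
        rw [sum_W_eq] at hτ
        have hp : ∑ t ∈ S, w₁ t - p ≠ 0 := sub_ne_zero.mpr hslope
        field_simp
        linarith
    choose! c hc using hfin
    -- a point of `[x, y]` avoiding all the `c S`
    have hinf : (Set.Icc x y).Infinite := Set.Icc_infinite hxy
    obtain ⟨τ, hτ, hτc⟩ := hinf.exists_notMem_finset ((indepSets i n).image c)
    -- the maximiser at `τ` agrees with the affine function there
    obtain ⟨S, hS, hSeq⟩ := exists_opt_eq w₁ w₀ i n τ
    have h1 : ∑ t ∈ S, W w₁ w₀ t τ = p * τ + q := by rw [← hSeq]; exact haff τ hτ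
    have h2 := hc S hS τ h1
    exact hτc (Finset.mem_image.mpr ⟨S, hS, h2.symm⟩)
  obtain ⟨S, hS, hSline⟩ := key
  -- then `S` is a maximiser at `x` and at `y`, hence `S = M` and `S = M'`
  have hSx : S = M := by
    by_contra h
    have := huM S hS h
    have h2 := sum_le_opt w₁ w₀ hM x
    rw [haff x ⟨le_rfl, hxy.le⟩, ← hSline x] at h2
    linarith
  have hSy : S = M' := by
    by_contra h
    have := huM' S hS h
    have h2 := sum_le_opt w₁ w₀ hM' y
    rw [haff y ⟨hxy.le, le_rfl⟩, ← hSline y] at h2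
    linarith
  exact hne (hSx.symm.trans hSy)

/-- **CHAINS OF UNIQUE OPTIMA HAVE `O(n log n)` TERMS.**  For the block `i+1, …, i+n` whose item lines have no vanishing alternating interval
sum, if `M_0, …, M_N` are unique maximisers at strictly increasing parameters with consecutive ones distinct, then
`N ≤ 66 · n · (⌊log₂ n⌋ + 2)`. [folklore] -/
theorem chain_le (i n : ℕ)
    (hG : ∀ u v : ℕ, i ≤ u → u < v → v ≤ i + n →
      (∑ t ∈ Finset.Ioc u v, (-1 : ℝ) ^ t * w₁ t ≠ 0 ∨ ∑ t ∈ Finset.Ioc u v, (-1 : ℝ) ^ t * w₀ t ≠ 0))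
    (N : ℕ) (θs : Fin (N + 1) → ℝ) (hθ : StrictMono θs) (Ms : Fin (N + 1) → Finset ℕ)
    (hmem : ∀ k, Ms k ∈ indepSets i n)
    (huniq : ∀ k, ∀ S ∈ indepSets i n, S ≠ Ms k → ∑ t ∈ S, W w₁ w₀ t (θs k) < ∑ t ∈ Ms k, W w₁ w₀ t (θs k))
    (hch : ∀ e : Fin N, Ms e.castSucc ≠ Ms e.succ) : N ≤ 66 * n * (Nat.log 2 n + 2) := by
  obtain ⟨K, hK, hPA⟩ := exists_cert_opt_of_altSum_ne w₁ w₀ i n hG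
  -- each gap `(θ_e, θ_{e+1})` contains a certificate point
  have hgap : ∀ e : Fin N, ∃ κ ∈ K, θs e.castSucc < κ ∧ κ < θs e.succ := by
    intro e
    by_contra hno
    push Not at hno
    have hfree : Free K (θs e.castSucc) (θs e.succ) := by
      intro k hk
      by_contra h
      push Not at h
      exact absurd (hno k hk h.1) (not_le.mpr h.2)
    have hlt : θs e.castSucc < θs e.succ := hθ (Fin.castSucc_lt_succ : e.castSucc < e.succ)
    obtain ⟨p, q, haff⟩ := hPA _ _ hlt.le hfree
    exact not_affine_of_unique w₁ w₀ hlt (hmem _) (huniq _) (hmem _) (huniq _) (hch e) p q haff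
  choose κ hκK hκ using hgap
  -- `e ↦ κ e` is strictly increasing, hence injective into `K`
  have hmono : StrictMono κ := by
    intro e e' hlt
    have h1 := (hκ e).2
    have h2 := (hκ e').1
    have h3 : θs e.succ ≤ θs e'.castSucc := by
      apply hθ.monotone
      rw [Fin.le_def]
      simp only [Fin.val_succ, Fin.val_castSucc]
      have : (e : ℕ) < e' := hlt
      omega
    linarith
  have hcard : N ≤ K.card := by
    have h1 : (Finset.univ.image κ).card = N := by
      rw [Finset.card_image_of_injective _ hmono.injective, Finset.card_univ, Fintype.card_fin]
    rw [← h1]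
    exact Finset.card_le_card fun x hx => by
      obtain ⟨e, _, rfl⟩ := Finset.mem_image.mp hx
      exact hκK e
  exact hcard.trans hK

end

end StaticPathFold

end Summit.ValiantsHypothesis.ValiantsHypothesis.Theorems.KPlusLogSqLaw
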